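import Mathlib.Analysis.SpecialFunctions.SmoothTransition
import Mathlib.MeasureTheory.Integral.IntervalIntegral.FundThmCalculus
import Mathlib.Analysis.Calculus.ContDiff.Deriv
import Mathlib.Analysis.Calculus.Deriv.MeanValue
import HarnessLib

/-!
# A smooth convex profile rounding the function `max(w, 0)` (for rounding creases of domains)

Topic `Literature/Topology/FourManifolds`; infrastructure for the fact seat
`provefact-Literature.Topology.FourManifolds.exists_isBalancedGKTrisection` (Gay–Kirby 2016,
Thm. 4 via Lemma 14).  Everything here is **proved**; no named facts are introduced.

Where two smooth hypersurfaces bounding a domain meet transversally the domain has a *crease*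
(in Lemma 14: where the sheet over the Heegaard surface `F` swept out by the flow meets the top
level of the middle region); the sectors of a trisection (Gay–Kirby, Def. 1) may have corners
only along the central surface, so such creases must be rounded ("straightening the angle",
Conner–Floyd; Douady, *Variétés à bord anguleux*, §6 "arrondissement des angles").  If the two
hypersurfaces are the zero sets of functions `u` and `v`, the union `{u ≥ 0} ∪ {v ≥ 0} =
{max(u, v) ≥ 0}` is rounded to `{u + σ_ε(v - u) ≥ 0}` with a smooth `σ_ε` equal to `max(·, 0)`
off `(-ε, ε)`.  This file constructs the profile:

* `creaseStep x = smoothTransition ((x + 1)/2)` — a smooth monotone step, `0` on `(-∞, -1]`,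
  `1` on `[1, ∞)`, with `∫_{-1}^{1} creaseStep = 1` (from the symmetry
  `smoothTransition x + smoothTransition (1 - x) = 1` of Mathlib's `Real.smoothTransition`);
* `creaseProfile x = ∫_{-1}^{x} creaseStep` — smooth (`contDiff_creaseProfile`), `= 0` on
  `(-∞, -1]`, `= x` on `[1, ∞)`, monotone with derivative in `[0, 1]`, and
  `max(x, 0) ≤ creaseProfile x` (`max_le_creaseProfile`), strictly increasing on `(-1, ∞)`;
* `creaseσ ε w = ε · creaseProfile (w/ε)` — the rescaled profile: smooth, `= 0` for `w ≤ -ε`,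
  `= w` for `w ≥ ε`, `max(w, 0) ≤ creaseσ ε w ≤ max(w, 0) + ε`, derivative
  `creaseStep (w/ε) ∈ [0, 1]`, strictly increasing on `(-ε, ∞)`.

## References

* A. Douady, *Variétés à bord anguleux et voisinages tubulaires*, Séminaire H. Cartan 14
  (1961/62), exp. 1, §6. [Douady1961]
* D. Gay, R. Kirby, *Trisecting 4-manifolds*, Geom. Topol. 20 (2016), Def. 1 and §4,
  Lemma 14. [GayKirby2016]
-/

open Set Real intervalIntegral
open scoped ContDiff Topology

noncomputable section

namespace Literature.Topology.FourManifolds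

/-! ### The symmetry of `smoothTransition` and its integral -/

/-- `smoothTransition x + smoothTransition (1 - x) = 1`. [folklore] -/
theorem smoothTransition_add_one_sub (x : ℝ) : smoothTransition x + smoothTransition (1 - x) = 1 := by
  have h := smoothTransition.pos_denom x
  rw [Real.smoothTransition, Real.smoothTransition, sub_sub_cancel,
    add_comm (expNegInvGlue (1 - x)) (expNegInvGlue x), ← add_div, div_self h.ne']

/-- `∫₀¹ smoothTransition = 1/2`. [folklore] -/
theorem integral_smoothTransition : ∫ x in (0 : ℝ)..1, smoothTransition x = 1 / 2 := by
  have hc : Continuous smoothTransition := smoothTransition.continuous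
  have hc' : Continuous fun x : ℝ => smoothTransition (1 - x) := hc.comp (continuous_const.sub continuous_id)
  have h1 : ∫ x in (0 : ℝ)..1, smoothTransition (1 - x) = ∫ x in (0 : ℝ)..1, smoothTransition x := by
    rw [intervalIntegral.integral_comp_sub_left (fun x => smoothTransition x) 1]
    norm_num
  have h2 : ∫ x in (0 : ℝ)..1, (smoothTransition x + smoothTransition (1 - x)) = 1 := by
    simp only [smoothTransition_add_one_sub, integral_const, sub_zero, smul_eq_mul, mul_one]
  rw [intervalIntegral.integral_add (hc.intervalIntegrable _ _) (hc'.intervalIntegrable _ _), h1] at h2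
  linarith

/-! ### The step -/

/-- The smooth monotone step `creaseStep x = smoothTransition ((x + 1)/2)`: `0` for `x ≤ -1`,
`1` for `x ≥ 1`. [folklore] -/
def creaseStep (x : ℝ) : ℝ := smoothTransition ((x + 1) / 2)

/-- The step is smooth. [folklore] -/
theorem contDiff_creaseStep : ContDiff ℝ ∞ creaseStep :=
  smoothTransition.contDiff.comp ((contDiff_id.add contDiff_const).div_const _)

/-- The step is continuous. [folklore] -/
theorem continuous_creaseStep : Continuous creaseStep := contDiff_creaseStep.continuous

/-- `0 ≤ creaseStep`. [folklore] -/
theorem creaseStep_nonneg (x : ℝ) : 0 ≤ creaseStep x := smoothTransition.nonneg _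

/-- `creaseStep ≤ 1`. [folklore] -/
theorem creaseStep_le_one (x : ℝ) : creaseStep x ≤ 1 := smoothTransition.le_one _

/-- The step is monotone. [folklore] -/
theorem monotone_creaseStep : Monotone creaseStep := fun x y h =>
  smoothTransition.monotone (by show (x + 1) / 2 ≤ (y + 1) / 2; linarith)

/-- `creaseStep x = 0` for `x ≤ -1`. [folklore] -/
theorem creaseStep_of_le_neg_one {x : ℝ} (hx : x ≤ -1) : creaseStep x = 0 :=
  smoothTransition.zero_of_nonpos (by linarith)

/-- `creaseStep x = 1` for `1 ≤ x`. [folklore] -/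
theorem creaseStep_of_one_le {x : ℝ} (hx : 1 ≤ x) : creaseStep x = 1 :=
  smoothTransition.one_of_one_le (by linarith)

/-- `0 < creaseStep x` for `-1 < x`. [folklore] -/
theorem creaseStep_pos {x : ℝ} (hx : -1 < x) : 0 < creaseStep x :=
  smoothTransition.pos_of_pos (by linarith)

/-- `creaseStep x < 1` for `x < 1`. [folklore] -/
theorem creaseStep_lt_one {x : ℝ} (hx : x < 1) : creaseStep x < 1 :=
  smoothTransition.lt_one_of_lt_one (by linarith)

/-- `∫_{-1}^{1} creaseStep = 1`. [folklore] -/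
theorem integral_creaseStep : ∫ x in (-1 : ℝ)..1, creaseStep x = 1 := by
  have h : (fun x => creaseStep x) = fun x => smoothTransition (1 / 2 + x / 2) := by
    ext x; simp only [creaseStep]; congr 1; ring
  rw [h, intervalIntegral.integral_comp_add_div (fun x => smoothTransition x) two_ne_zero]
  norm_num [integral_smoothTransition]

/-! ### The profile -/

/-- **The crease profile** `creaseProfile x = ∫_{-1}^{x} creaseStep`: a smooth convex function
equal to `0` on `(-∞, -1]` and to `x` on `[1, ∞)`. [cite: Douady1961, §6] -/
def creaseProfile (x : ℝ) : ℝ := ∫ t in (-1 : ℝ)..x, creaseStep t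

/-- The derivative of the profile is the step. [folklore] -/
theorem hasDerivAt_creaseProfile (x : ℝ) : HasDerivAt creaseProfile (creaseStep x) x :=
  (continuous_creaseStep.integral_hasStrictDerivAt (-1) x).hasDerivAt

/-- `creaseProfile' = creaseStep`. [folklore] -/
theorem deriv_creaseProfile : deriv creaseProfile = creaseStep :=
  funext fun x => (hasDerivAt_creaseProfile x).deriv

/-- The profile is differentiable. [folklore] -/
theorem differentiable_creaseProfile : Differentiable ℝ creaseProfile := fun x =>
  (hasDerivAt_creaseProfile x).differentiableAt

/-- **The profile is smooth.** [folklore] -/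
theorem contDiff_creaseProfile : ContDiff ℝ ∞ creaseProfile :=
  contDiff_infty_iff_deriv.2 ⟨differentiable_creaseProfile, by rw [deriv_creaseProfile]; exact contDiff_creaseStep⟩

/-- The profile is continuous. [folklore] -/
theorem continuous_creaseProfile : Continuous creaseProfile := differentiable_creaseProfile.continuous

/-- `creaseProfile x = 0` for `x ≤ -1`. [folklore] -/
theorem creaseProfile_of_le_neg_one {x : ℝ} (hx : x ≤ -1) : creaseProfile x = 0 := by
  unfold creaseProfile
  rw [intervalIntegral.integral_congr (g := fun _ => (0 : ℝ)) (fun t ht => ?_), intervalIntegral.integral_zero]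
  rw [uIcc_of_ge hx] at ht
  exact creaseStep_of_le_neg_one ht.2

/-- `creaseProfile (-1) = 0`. [folklore] -/
theorem creaseProfile_neg_one : creaseProfile (-1) = 0 := creaseProfile_of_le_neg_one le_rfl

/-- `creaseProfile x = x` for `1 ≤ x`. [folklore] -/
theorem creaseProfile_of_one_le {x : ℝ} (hx : 1 ≤ x) : creaseProfile x = x := by
  unfold creaseProfile
  have hi : ∀ a b : ℝ, IntervalIntegrable creaseStep MeasureTheory.volume a b := fun a b =>
    continuous_creaseStep.intervalIntegrable a b
  rw [← intervalIntegral.integral_add_adjacent_intervals (hi (-1) 1) (hi 1 x), integral_creaseStep]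
  have h : ∫ t in (1 : ℝ)..x, creaseStep t = ∫ _ in (1 : ℝ)..x, (1 : ℝ) :=
    intervalIntegral.integral_congr fun t ht => by
      rw [uIcc_of_le hx] at ht
      exact creaseStep_of_one_le ht.1
  rw [h, integral_const, smul_eq_mul, mul_one]
  ring

/-- The profile is monotone. [folklore] -/
theorem monotone_creaseProfile : Monotone creaseProfile :=
  monotone_of_deriv_nonneg differentiable_creaseProfile fun x => by
    rw [deriv_creaseProfile]; exact creaseStep_nonneg x

/-- `0 ≤ creaseProfile`. [folklore] -/
theorem creaseProfile_nonneg (x : ℝ) : 0 ≤ creaseProfile x := by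
  rcases le_total x (-1) with h | h
  · rw [creaseProfile_of_le_neg_one h]
  · rw [← creaseProfile_neg_one]; exact monotone_creaseProfile h

/-- `x ≤ creaseProfile x` (the function `creaseProfile x - x` is nonincreasing and vanishes on
`[1, ∞)`). [folklore] -/
theorem le_creaseProfile (x : ℝ) : x ≤ creaseProfile x := by
  have hanti : Antitone fun y => creaseProfile y - y := by
    apply antitone_of_deriv_nonpos (differentiable_creaseProfile.sub differentiable_id)
    intro y
    rw [deriv_sub (differentiable_creaseProfile y) differentiableAt_id, deriv_creaseProfile, deriv_id]
    linarith [creaseStep_le_one y]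
  rcases le_total x 1 with h | h
  · have h1 : creaseProfile 1 - 1 ≤ creaseProfile x - x := hanti h
    rw [creaseProfile_of_one_le le_rfl] at h1
    linarith
  · rw [creaseProfile_of_one_le h]

/-- **`max(x, 0) ≤ creaseProfile x`.** [folklore] -/
theorem max_le_creaseProfile (x : ℝ) : max x 0 ≤ creaseProfile x :=
  max_le (le_creaseProfile x) (creaseProfile_nonneg x)

/-- `creaseProfile x ≤ max(x, 0) + 1` (crude). [folklore] -/
theorem creaseProfile_le (x : ℝ) : creaseProfile x ≤ max x 0 + 1 := by
  rcases le_total x 1 with h | h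
  · have h1 : creaseProfile x ≤ creaseProfile 1 := monotone_creaseProfile h
    rw [creaseProfile_of_one_le le_rfl] at h1
    linarith [le_max_right x 0]
  · rw [creaseProfile_of_one_le h]
    linarith [le_max_left x 0]

/-- The profile is strictly increasing on `[-1, ∞)`. [folklore] -/
theorem strictMonoOn_creaseProfile : StrictMonoOn creaseProfile (Ici (-1)) := by
  apply strictMonoOn_of_deriv_pos (convex_Ici _) continuous_creaseProfile.continuousOn
  intro x hx
  rw [interior_Ici] at hx
  rw [deriv_creaseProfile]
  exact creaseStep_pos hx

/-! ### The rescaled profile `σ_ε` -/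

/-- **The rescaled crease profile** `σ_ε(w) = ε · creaseProfile (w / ε)`: smooth, `= 0` for
`w ≤ -ε`, `= w` for `w ≥ ε`, `max(w, 0) ≤ σ_ε(w) ≤ max(w, 0) + ε`, `σ_ε' ∈ [0, 1]`.
[cite: Douady1961, §6] -/
def creaseσ (ε w : ℝ) : ℝ := ε * creaseProfile (w / ε)

variable {ε : ℝ}

/-- `σ_ε` is smooth. [folklore] -/
theorem contDiff_creaseσ (ε : ℝ) : ContDiff ℝ ∞ (creaseσ ε) :=
  contDiff_const.mul (contDiff_creaseProfile.comp (contDiff_id.div_const _))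

/-- `σ_ε` is continuous. [folklore] -/
theorem continuous_creaseσ (ε : ℝ) : Continuous (creaseσ ε) := (contDiff_creaseσ ε).continuous

/-- `σ_ε(w) = 0` for `w ≤ -ε`. [folklore] -/
theorem creaseσ_of_le_neg (hε : 0 < ε) {w : ℝ} (hw : w ≤ -ε) : creaseσ ε w = 0 := by
  rw [creaseσ, creaseProfile_of_le_neg_one, mul_zero]
  rw [div_le_iff₀ hε]; linarith

/-- `σ_ε(w) = w` for `ε ≤ w`. [folklore] -/
theorem creaseσ_of_le (hε : 0 < ε) {w : ℝ} (hw : ε ≤ w) : creaseσ ε w = w := by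
  rw [creaseσ, creaseProfile_of_one_le, mul_div_cancel₀ _ hε.ne']
  rw [le_div_iff₀ hε]; linarith

/-- The derivative of `σ_ε` is `creaseStep (w / ε)`. [folklore] -/
theorem hasDerivAt_creaseσ (hε : 0 < ε) (w : ℝ) : HasDerivAt (creaseσ ε) (creaseStep (w / ε)) w := by
  have h2 := ((hasDerivAt_creaseProfile (w / ε)).comp w ((hasDerivAt_id w).div_const ε)).const_mul ε
  have h3 : ε * (creaseStep (w / ε) * (1 / ε)) = creaseStep (w / ε) := by
    field_simp
  rw [h3] at h2
  exact h2

/-- `0 ≤ σ_ε'`. [folklore] -/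
theorem deriv_creaseσ_nonneg (hε : 0 < ε) (w : ℝ) : 0 ≤ deriv (creaseσ ε) w := by
  rw [(hasDerivAt_creaseσ hε w).deriv]; exact creaseStep_nonneg _

/-- `σ_ε' ≤ 1`. [folklore] -/
theorem deriv_creaseσ_le_one (hε : 0 < ε) (w : ℝ) : deriv (creaseσ ε) w ≤ 1 := by
  rw [(hasDerivAt_creaseσ hε w).deriv]; exact creaseStep_le_one _

/-- `σ_ε' < 1` for `w < ε`. [folklore] -/
theorem deriv_creaseσ_lt_one (hε : 0 < ε) {w : ℝ} (hw : w < ε) : deriv (creaseσ ε) w < 1 := by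
  rw [(hasDerivAt_creaseσ hε w).deriv]
  exact creaseStep_lt_one (by rw [div_lt_one hε]; exact hw)

/-- `σ_ε` is monotone. [folklore] -/
theorem monotone_creaseσ (hε : 0 < ε) : Monotone (creaseσ ε) := fun _ _ h =>
  mul_le_mul_of_nonneg_left (monotone_creaseProfile (div_le_div_of_nonneg_right h hε.le)) hε.le

/-- **`max(w, 0) ≤ σ_ε(w)`.** [folklore] -/
theorem max_le_creaseσ (hε : 0 < ε) (w : ℝ) : max w 0 ≤ creaseσ ε w := by
  have h := max_le_creaseProfile (w / ε)
  have h2 : max w 0 = ε * max (w / ε) 0 := by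
    rw [mul_max_of_nonneg _ _ hε.le, mul_div_cancel₀ _ hε.ne', mul_zero]
  rw [h2, creaseσ]
  exact mul_le_mul_of_nonneg_left h hε.le

/-- `σ_ε(w) ≤ max(w, 0) + ε`. [folklore] -/
theorem creaseσ_le (hε : 0 < ε) (w : ℝ) : creaseσ ε w ≤ max w 0 + ε := by
  have h := creaseProfile_le (w / ε)
  have h2 : max w 0 + ε = ε * (max (w / ε) 0 + 1) := by
    rw [mul_add, mul_max_of_nonneg _ _ hε.le, mul_div_cancel₀ _ hε.ne', mul_zero, mul_one]
  rw [h2, creaseσ]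
  exact mul_le_mul_of_nonneg_left h hε.le

/-- `0 ≤ σ_ε`. [folklore] -/
theorem creaseσ_nonneg (hε : 0 < ε) (w : ℝ) : 0 ≤ creaseσ ε w :=
  (le_max_right w 0).trans (max_le_creaseσ hε w)

/-- `w ≤ σ_ε(w)`. [folklore] -/
theorem le_creaseσ (hε : 0 < ε) (w : ℝ) : w ≤ creaseσ ε w :=
  (le_max_left w 0).trans (max_le_creaseσ hε w)

/-- `σ_ε` is strictly increasing on `[-ε, ∞)`. [folklore] -/
theorem strictMonoOn_creaseσ (hε : 0 < ε) : StrictMonoOn (creaseσ ε) (Ici (-ε)) := by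
  intro x hx y hy hxy
  have hx' : x / ε ∈ Ici (-1 : ℝ) := by
    show -1 ≤ x / ε; rw [le_div_iff₀ hε]; have : -ε ≤ x := hx; linarith
  have hy' : y / ε ∈ Ici (-1 : ℝ) := by
    show -1 ≤ y / ε; rw [le_div_iff₀ hε]; have : -ε ≤ y := hy; linarith
  exact mul_lt_mul_of_pos_left (strictMonoOn_creaseProfile hx' hy' (div_lt_div_of_pos_right hxy hε)) hε

end Literature.Topology.FourManifolds

end
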